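import Mathlib.Data.Complex.Basic
import Mathlib.NumberTheory.Zsqrtd.GaussianInt
import Mathlib.Algebra.BigOperators.Fin
import Mathlib.Algebra.BigOperators.Ring.Finset
import Mathlib.Data.Fin.Tuple.Basic
import Mathlib.Data.Fintype.Pi
import Mathlib.Data.List.GetD
import HarnessLib

/-!
# Exponential sums of `ℤ₄`-valued quadratic forms over `𝔽₂` (the Clifford "Gauss sums")

Topic `Literature/Computability/QuantumComplexity`, sub-namespace `BravyiGosset` (the line of files
discharging the named fact `BravyiGosset2016_estimateAcceptProb` of `StabilizerSimulation.lean`: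
Bravyi–Gosset's `2^{t/2} · poly` Monte-Carlo estimator of Clifford+`T` output probabilities).

Every amplitude of a Clifford circuit, and every inner product between a stabilizer-type "phase
state" and the output of a Clifford circuit, is a normalised **exponential sum of a quadratic form**
```
  Γ(μ, Λ, B) = Σ_{w ∈ 𝔽₂^k} i^{μ + Σ_j Λ_j w_j} · (−1)^{Σ_{j < l} B_{lj} w_l w_j},   μ, Λ_j ∈ ℤ₄, B_{lj} ∈ 𝔽₂,
```
(Dehaene–De Moor 2003, Thm. 1–2; Van den Nest 2010, §3: stabilizer states are
`|ψ⟩ ∝ Σ_{x ∈ A} i^{ℓ(x)} (−1)^{q(x)} |x⟩` with `ℓ` linear and `q` quadratic; Bravyi–Gosset 2016,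
App. A: `ℤ₈`-valued quadratic forms `q(x) = Q + Σ D_a x_a + Σ J_{ab} x_a x_b` (eq. (qform3)),
the standard form `|K, q⟩` (Lemma 4) and the exponential sums `W(q) = Σ_x e^{iπ q(x)/4}` (eq. (W));
our `Γ` is `W(q)` for the forms with even coefficients `Q = 2μ`, `D = 2Λ`, `J = 4B`). Such a sum is
evaluated **exactly** in `poly(k)` arithmetic operations (Bravyi–Gosset 2016, App. A, the
`O(k³)` subroutine `ExponentialSum`, there organised through a canonical dimer/monomer basis; here
by eliminating one variable at a time with the elementary identities
`Σ_{x ∈ 𝔽₂} i^{λ x} (−1)^{x L} = (1 + i) i^{…}` for odd `λ` and `= 2·[L = λ/2]` for even `λ`). This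
file is the machine-independent core of that subroutine in the exact shape the polynomial-time
code of the sequel computes:

* `BravyiGosset.AffForm` — affine forms `c ⊕ ⊕_j a_j w_j` over `𝔽₂` as coefficient lists, `eval`,
  their integer lift `lift` and the **parity identity** `i^{(Σ_j x_j) mod 2} = i^{Σ_j x_j} (−1)^{e₂(x)}`
  (`I_pow_mod_two_eq`), by which `i^{[affine form]}` is again of the shape `i^{linear} (−1)^{quadratic}`;
* `BravyiGosset.GData` — the data `(μ, Λ, B)` as lists (`B` lower-triangular ragged rows, row `l` =
  couplings of variable `l` to the variables `j < l`), its value `GData.val k w` at a valuation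
  `w : Fin k → Bool` of `k` ambient variables, and the two closure operations `addPhaseForm`
  (multiply by `i^{κ [f(w)]}`) and `addQuadProduct` (multiply by `(−1)^{[f(w)][g(w)]}`) with their
  value theorems;
* `GData.elimStep`, `GData.gaussEval` — elimination of the last variable and the
  resulting evaluator with values in Mathlib's Gaussian integers `ℤ[i]`, and the **correctness theorem**
  `toComplex_gaussEval`: `gaussEval k D = Σ_{w : Fin k → Bool} D.val k w` in `ℂ`.

All definitions are total functions on lists (entries beyond the end of a list read as `0`), so no
well-formedness predicate is needed for the value theorems; list shapes only matter for the size
analysis of the sequel.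

## References

* S. Bravyi, D. Gosset, *Improved classical simulation of quantum circuits dominated by Clifford
  gates*, Phys. Rev. Lett. 116 (2016) 250501, arXiv:1601.07601v3: App. A (quadratic forms over
  `𝔽₂` with `ℤ₈` values, Def. 1, Lemmas 3–4, eq. (W) and the subroutine `ExponentialSum`), App. B
  (standard form of stabilizer states), App. C (inner products).
* J. Dehaene, B. De Moor, *Clifford group, stabilizer states, and linear and quadratic operations
  over GF(2)*, Phys. Rev. A 68 (2003) 042318, Thm. 1–2.
* M. Van den Nest, *Classical simulation of quantum computation, the Gottesman–Knill theorem, and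
  slightly beyond*, Quantum Inf. Comput. 10 (2010) 258–271, §3.
-/

namespace Literature.Computability.QuantumComplexity.BravyiGosset

open Complex Finset

/-! ### Bits, valuations and the phase arithmetic of `i` and `−1` -/

/-- Bits enter the exponents through core's `Bool.toNat` (`[b] ∈ {0, 1}`); `[a ∧ b] = [a] [b]`.
[folklore] -/
theorem toNat_and (a b : Bool) : Bool.toNat (a && b) = Bool.toNat a * Bool.toNat b := by
  cases a <;> cases b <;> rfl

/-- `[n is odd]` recovers `n mod 2`. [folklore] -/
theorem toNat_decide_mod_two (n : ℕ) : Bool.toNat (decide (n % 2 = 1)) = n % 2 := by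
  rcases Nat.mod_two_eq_zero_or_one n with h | h <;> simp [h]

/-- `[a ⊕ b] ≡ [a] + [b] (mod 2)`. [folklore] -/
theorem toNat_xor_mod_two (a b : Bool) : Bool.toNat (a ^^ b) = (Bool.toNat a + Bool.toNat b) % 2 := by
  cases a <;> cases b <;> rfl

/-- Bit `j` of a valuation of `k` ambient variables, read by a natural-number index (`false` out of
range). [folklore] -/
def wbit {k : ℕ} (w : Fin k → Bool) (j : ℕ) : Bool := if h : j < k then w ⟨j, h⟩ else false

/-- In range, `wbit` is the value. [folklore] -/
theorem wbit_of_lt {k : ℕ} (w : Fin k → Bool) {j : ℕ} (h : j < k) : wbit w j = w ⟨j, h⟩ := dif_pos h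

/-- At a `Fin` index, `wbit` is the value. [folklore] -/
@[simp] theorem wbit_fin {k : ℕ} (w : Fin k → Bool) (j : Fin k) : wbit w j = w j := by
  rw [wbit_of_lt w j.2]

/-- Out of range, `wbit` is `false`. [folklore] -/
theorem wbit_of_le {k : ℕ} (w : Fin k → Bool) {j : ℕ} (h : k ≤ j) : wbit w j = false :=
  dif_neg (Nat.not_lt.2 h)

/-- Bits of an updated valuation. [folklore] -/
theorem wbit_update {k : ℕ} (w : Fin k → Bool) (p : Fin k) (c : Bool) (j : ℕ) :
    wbit (Function.update w p c) j = if j = (p : ℕ) then c else wbit w j := by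
  by_cases hj : j < k
  · rw [wbit_of_lt _ hj, wbit_of_lt _ hj]
    by_cases hjp : j = (p : ℕ)
    · subst hjp
      simp
    · rw [if_neg hjp, Function.update_of_ne]
      exact fun h => hjp (by rw [← h])
  · rw [wbit_of_le _ (Nat.not_lt.1 hj), wbit_of_le _ (Nat.not_lt.1 hj), if_neg]
    intro h; exact hj (h ▸ p.2)

/-- Bits of a valuation extended by a last variable. [folklore] -/
theorem wbit_snoc {k : ℕ} (w : Fin k → Bool) (c : Bool) (j : ℕ) :
    wbit (Fin.snoc w c : Fin (k + 1) → Bool) j = if j = k then c else wbit w j := by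
  by_cases hjk : j = k
  · subst hjk
    rw [if_pos rfl, wbit_of_lt _ (Nat.lt_succ_self j)]
    exact Fin.snoc_last (α := fun _ => Bool) (x := c) (p := w)
  · rw [if_neg hjk]
    by_cases hj : j < k
    · rw [wbit_of_lt _ hj, wbit_of_lt _ (Nat.lt_succ_of_lt hj)]
      exact Fin.snoc_castSucc (α := fun _ => Bool) c w ⟨j, hj⟩
    · have hle : k + 1 ≤ j := by omega
      rw [wbit_of_le _ hle, wbit_of_le _ (Nat.not_lt.1 hj)]

/-- Powers of `i` depend on the exponent modulo `4` (Mathlib's `Complex.I_pow_eq_pow_mod`).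
[folklore] -/
theorem I_pow_eq_of_mod_eq {a b : ℕ} (h : a % 4 = b % 4) : I ^ a = I ^ b := by
  rw [Complex.I_pow_eq_pow_mod a, Complex.I_pow_eq_pow_mod b, h]

/-- Powers of `−1` depend on the exponent modulo `2` (Mathlib's `neg_one_pow_eq_pow_mod_two`).
[folklore] -/
theorem neg_one_pow_eq_of_mod_eq {a b : ℕ} (h : a % 2 = b % 2) : (-1 : ℂ) ^ a = (-1 : ℂ) ^ b := by
  rw [neg_one_pow_eq_pow_mod_two a, neg_one_pow_eq_pow_mod_two b, h]

/-- `i^{2n} = (−1)^n`. [folklore] -/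
theorem I_pow_two_mul (n : ℕ) : I ^ (2 * n) = (-1 : ℂ) ^ n := by
  rw [pow_mul, Complex.I_sq]

/-- `(−1)^{[b]} = ±1` squares to one: `(−1)^a (−1)^a = 1`. [folklore] -/
theorem neg_one_pow_mul_self (a : ℕ) : (-1 : ℂ) ^ a * (-1 : ℂ) ^ a = 1 := by
  rw [← pow_add, ← two_mul, pow_mul]; simp

/-- **The parity identity.** For `0/1`-valued `x`, with `S_n = Σ_{j<n} x_j` and the elementary
symmetric count `E_n = Σ_{j<n} x_j S_j = Σ_{l<j<n} x_j x_l`: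
`i^{S_n mod 2} = i^{S_n} · (−1)^{E_n}`. This is how `i` raised to an `𝔽₂`-linear form is rewritten
as `i^{ℤ-linear} · (−1)^{quadratic}` (Dehaene–De Moor 2003, proof of Thm. 2; it is the reason
Bravyi–Gosset's forms take values in `ℤ₈ ⊇ 2ℤ₈ ≅ ℤ₄`, App. A). [folklore] -/
theorem I_pow_mod_two_eq (x : ℕ → ℕ) (hx : ∀ j, x j ≤ 1) (n : ℕ) :
    I ^ ((∑ j ∈ range n, x j) % 2) =
      I ^ (∑ j ∈ range n, x j) * (-1 : ℂ) ^ (∑ j ∈ range n, x j * ∑ l ∈ range j, x l) := by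
  induction n with
  | zero => simp
  | succ n ih =>
    rw [sum_range_succ, sum_range_succ (fun j => x j * ∑ l ∈ range j, x l)]
    set S := ∑ j ∈ range n, x j with hS
    set E := ∑ j ∈ range n, x j * ∑ l ∈ range j, x l with hE
    rcases Nat.le_one_iff_eq_zero_or_eq_one.1 (hx n) with h0 | h1
    · rw [h0]; simpa using ih
    · rw [h1, one_mul, pow_add, pow_add, pow_one]
      -- `i^{(S+1) mod 2} = i^S (-1)^E · i · (-1)^S`
      rcases Nat.mod_two_eq_zero_or_one S with he | ho
      · have hS2 : (S + 1) % 2 = 1 := by omega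
        rw [hS2, pow_one]
        have h1' : I ^ S * (-1 : ℂ) ^ E = 1 := by rw [← ih, he, pow_zero]
        have hSe : (-1 : ℂ) ^ S = 1 := by rw [neg_one_pow_eq_pow_mod_two, he, pow_zero]
        calc I = (I ^ S * (-1) ^ E) * I * 1 := by rw [h1', one_mul, mul_one]
          _ = I ^ S * I * ((-1) ^ E * (-1) ^ S) := by rw [hSe]; ring
      · have hS2 : (S + 1) % 2 = 0 := by omega
        rw [hS2, pow_zero]
        have h1' : I ^ S * (-1 : ℂ) ^ E = I := by rw [← ih, ho, pow_one]
        have hSo : (-1 : ℂ) ^ S = -1 := by rw [neg_one_pow_eq_pow_mod_two, ho, pow_one]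
        calc (1 : ℂ) = -(I * I) := by rw [Complex.I_mul_I, neg_neg]
          _ = (I ^ S * (-1) ^ E) * I * (-1) := by rw [h1']; ring
          _ = I ^ S * I * ((-1) ^ E * (-1) ^ S) := by rw [hSo]; ring

/-! ### Sums over all valuations -/

/-- Splitting a sum over valuations of `k + 1` variables along the **last** variable.
[folklore] -/
theorem sum_snoc {M : Type*} [AddCommMonoid M] {k : ℕ} (G : (Fin (k + 1) → Bool) → M) :
    ∑ w : Fin (k + 1) → Bool, G w =
      ∑ w : Fin k → Bool, (G (Fin.snoc w false) + G (Fin.snoc w true)) := by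
  rw [← (Fin.snocEquiv fun _ => Bool).sum_comp G, Fintype.sum_prod_type, Fintype.sum_bool,
    ← Finset.sum_add_distrib]
  refine Finset.sum_congr rfl fun w _ => ?_
  rw [add_comm]
  rfl

/-- Updating the inserted coordinate replaces the inserted value. [folklore] -/
theorem update_insertNth {k : ℕ} (p : Fin (k + 1)) (c d : Bool) (w : Fin k → Bool) :
    Function.update (Fin.insertNth p c w : Fin (k + 1) → Bool) p d = Fin.insertNth p d w := by
  funext j
  refine Fin.succAboveCases p ?_ (fun i => ?_) j
  · rw [Function.update_self, Fin.insertNth_apply_same]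
  · rw [Function.update_of_ne (Fin.succAbove_ne p i), Fin.insertNth_apply_succAbove,
      Fin.insertNth_apply_succAbove]

/-- **Pairing along a coordinate.** If `φ` does not depend on coordinate `p`, then summing
`G (w[p ↦ φ w])` over all `w` counts every valuation satisfying `w p = φ w` twice.
[folklore] -/
theorem sum_update_eq_two_mul {k : ℕ} (p : Fin (k + 1)) (G : (Fin (k + 1) → Bool) → ℂ)
    (φ : (Fin (k + 1) → Bool) → Bool) (hφ : ∀ w c, φ (Function.update w p c) = φ w) :
    ∑ w : Fin (k + 1) → Bool, G (Function.update w p (φ w)) =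
      2 * ∑ w : Fin (k + 1) → Bool, (if w p = φ w then G w else 0) := by
  rw [← (Fin.insertNthEquiv (fun _ => Bool) p).sum_comp
      (fun w => G (Function.update w p (φ w))),
    ← (Fin.insertNthEquiv (fun _ => Bool) p).sum_comp
      (fun w => if w p = φ w then G w else 0),
    Fintype.sum_prod_type_right, Fintype.sum_prod_type_right, Finset.mul_sum]
  refine Finset.sum_congr rfl fun y _ => ?_
  have happ : ∀ (c : Bool) (y : Fin k → Bool),
      (Fin.insertNthEquiv (fun _ => Bool) p) (c, y) = Fin.insertNth p c y := fun _ _ => rfl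
  have hins : ∀ (c : Bool) (w : Fin k → Bool),
      φ (Fin.insertNth p c w) = φ (Fin.insertNth p false w) := fun c w => by
    rw [← update_insertNth p false c w, hφ]
  simp only [happ, update_insertNth, hins, Fin.insertNth_apply_same, Fintype.sum_bool]
  cases φ (Fin.insertNth p false y) <;> simp [two_mul]

/-! ### Affine forms over `𝔽₂` -/

/-- An affine form `c ⊕ ⊕_j a_j w_j` over `𝔽₂` in the ambient variables `w_0, w_1, …`: a constant
bit and a coefficient list (coefficients beyond the end of the list are `0`).
[cite: BravyiGosset2016, App. A (affine spaces `K = L(K) ⊕ h` over `𝔽₂`)] -/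
structure AffForm where
  /-- The constant term. -/
  c : Bool
  /-- The coefficients `a_0, a_1, …`. -/
  a : List Bool
  deriving DecidableEq, Inhabited

namespace AffForm

/-- Coefficient `a_j` (`false` beyond the end). [folklore] -/
def coef (f : AffForm) (j : ℕ) : Bool := f.a.getD j false

/-- The integer lift `[c] + Σ_{j<k} [a_j ∧ w_j]` of the form at a valuation of `k` ambient
variables. [folklore] -/
def lift {k : ℕ} (f : AffForm) (w : Fin k → Bool) : ℕ :=
  Bool.toNat f.c + ∑ j ∈ range k, Bool.toNat (f.coef j && wbit w j)

/-- The value `c ⊕ ⊕_{j<k} a_j w_j ∈ 𝔽₂` of the form (the parity of its lift). [folklore] -/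
def eval {k : ℕ} (f : AffForm) (w : Fin k → Bool) : Bool := decide (f.lift w % 2 = 1)

/-- The constant form. [folklore] -/
def const (c : Bool) : AffForm := ⟨c, []⟩

/-- The coordinate form `w_j`. [folklore] -/
def unit (j : ℕ) : AffForm := ⟨false, List.replicate j false ++ [true]⟩

/-- Coefficientwise `xor` of two lists, the shorter one padded with `false`. [folklore] -/
def bxor : List Bool → List Bool → List Bool
  | [], v => v
  | u, [] => u
  | x :: u, y :: v => (x ^^ y) :: bxor u v

/-- Sum of two affine forms. [folklore] -/
def add (f g : AffForm) : AffForm := ⟨f.c ^^ g.c, bxor f.a g.a⟩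

/-- Adding a constant. [folklore] -/
def addConst (f : AffForm) (b : Bool) : AffForm := ⟨f.c ^^ b, f.a⟩

/-- `bxor` is coefficientwise `xor`. [folklore] -/
theorem getD_bxor (u v : List Bool) (j : ℕ) :
    (bxor u v).getD j false = (u.getD j false ^^ v.getD j false) := by
  induction u generalizing v j with
  | nil => cases v <;> simp [bxor]
  | cons x u ih =>
    cases v with
    | nil => simp [bxor]
    | cons y v =>
      cases j with
      | zero => simp [bxor]
      | succ j =>
        simp only [bxor, List.getD_cons_succ]
        exact ih v j

/-- The length of `bxor u v` is the larger length. [folklore] -/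
theorem length_bxor (u v : List Bool) : (bxor u v).length = max u.length v.length := by
  induction u generalizing v with
  | nil => cases v <;> simp [bxor]
  | cons x u ih =>
    cases v with
    | nil => simp [bxor]
    | cons y v => simp [bxor, ih, Nat.succ_max_succ]

/-- Coefficients of a sum. [folklore] -/
@[simp] theorem coef_add (f g : AffForm) (j : ℕ) : (f.add g).coef j = (f.coef j ^^ g.coef j) :=
  getD_bxor _ _ _

/-- Coefficients of the constant form vanish. [folklore] -/
@[simp] theorem coef_const (c : Bool) (j : ℕ) : (const c).coef j = false := by
  simp [const, coef]

/-- Coefficients of `addConst`. [folklore] -/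
@[simp] theorem coef_addConst (f : AffForm) (b : Bool) (j : ℕ) : (f.addConst b).coef j = f.coef j :=
  rfl

/-- Coefficients of the coordinate form. [folklore] -/
theorem coef_unit (i j : ℕ) : (unit i).coef j = decide (j = i) := by
  unfold unit coef
  simp only
  rcases Nat.lt_trichotomy j i with h | h | h
  · rw [List.getD_append _ _ _ _ (by simpa using h)]
    simp [h, Nat.ne_of_lt h]
  · subst h
    rw [List.getD_append_right _ _ _ _ (by simp)]
    simp
  · rw [List.getD_eq_default _ _ (by simp; omega)]
    simp [Nat.ne_of_gt h]

/-- The lift of a form, modulo `2`, is additive. [folklore] -/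
theorem lift_add_mod_two {k : ℕ} (f g : AffForm) (w : Fin k → Bool) :
    (f.add g).lift w % 2 = (f.lift w + g.lift w) % 2 := by
  unfold lift
  have hc : Bool.toNat (f.add g).c = (Bool.toNat f.c + Bool.toNat g.c) % 2 := toNat_xor_mod_two _ _
  have hs : (∑ j ∈ range k, Bool.toNat ((f.add g).coef j && wbit w j)) % 2 =
      (∑ j ∈ range k, Bool.toNat (f.coef j && wbit w j) + ∑ j ∈ range k, Bool.toNat (g.coef j && wbit w j)) % 2 := by
    rw [← Finset.sum_add_distrib, Finset.sum_nat_mod, Finset.sum_congr rfl fun j _ => ?_,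
      ← Finset.sum_nat_mod]
    rw [coef_add]
    cases f.coef j <;> cases g.coef j <;> cases wbit w j <;> rfl
  show (Bool.toNat (f.add g).c + _) % 2 = _
  rw [hc]
  omega

/-- **Evaluation is additive.** [folklore] -/
theorem eval_add {k : ℕ} (f g : AffForm) (w : Fin k → Bool) :
    (f.add g).eval w = (f.eval w ^^ g.eval w) := by
  unfold eval
  rw [lift_add_mod_two]
  rcases Nat.mod_two_eq_zero_or_one (f.lift w) with h1 | h1 <;>
    rcases Nat.mod_two_eq_zero_or_one (g.lift w) with h2 | h2 <;>
    simp [Nat.add_mod, h1, h2]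

/-- The constant form evaluates to its constant. [folklore] -/
@[simp] theorem eval_const {k : ℕ} (c : Bool) (w : Fin k → Bool) : (const c).eval w = c := by
  unfold eval lift
  rw [Finset.sum_eq_zero (fun j _ => by simp)]
  cases c <;> simp [const]

/-- Adding a constant flips the value accordingly. [folklore] -/
theorem eval_addConst {k : ℕ} (f : AffForm) (b : Bool) (w : Fin k → Bool) :
    (f.addConst b).eval w = (f.eval w ^^ b) := by
  have hl : (f.addConst b).lift w % 2 = (f.lift w + Bool.toNat b) % 2 := by
    unfold lift
    have hc : Bool.toNat (f.addConst b).c = (Bool.toNat f.c + Bool.toNat b) % 2 := toNat_xor_mod_two _ _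
    have hs : (∑ j ∈ range k, Bool.toNat ((f.addConst b).coef j && wbit w j)) =
        ∑ j ∈ range k, Bool.toNat (f.coef j && wbit w j) := rfl
    rw [hc, hs]
    omega
  unfold eval
  rw [hl]
  cases b <;> rcases Nat.mod_two_eq_zero_or_one (f.lift w) with h | h <;> simp [Nat.add_mod, h]

/-- The coordinate form `w_i` evaluates to bit `i` (in range). [folklore] -/
theorem eval_unit {k : ℕ} (i : ℕ) (hi : i < k) (w : Fin k → Bool) :
    (unit i).eval w = w ⟨i, hi⟩ := by
  unfold eval lift
  rw [Finset.sum_eq_single i, coef_unit]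
  · simp only [decide_true, Bool.true_and, wbit_of_lt w hi]
    cases w ⟨i, hi⟩ <;> simp [unit]
  · intro j _ hji
    rw [coef_unit]
    simp [hji]
  · intro h
    exact absurd (Finset.mem_range.2 hi) h

/-- The lift only reads the bits `j` with `a_j ≠ 0`; in particular a form with coefficient list of
length `≤ p` does not see bit `p`. [folklore] -/
theorem lift_update_of_coef {k : ℕ} (f : AffForm) (w : Fin k → Bool) (p : Fin k) (c : Bool)
    (hp : f.coef p = false) : f.lift (Function.update w p c) = f.lift w := by
  unfold lift
  congr 1
  refine Finset.sum_congr rfl fun j _ => ?_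
  rw [wbit_update]
  by_cases hj : j = (p : ℕ)
  · subst hj; simp [hp]
  · rw [if_neg hj]

/-- Evaluation does not depend on a bit whose coefficient vanishes. [folklore] -/
theorem eval_update_of_coef {k : ℕ} (f : AffForm) (w : Fin k → Bool) (p : Fin k) (c : Bool)
    (hp : f.coef p = false) : f.eval (Function.update w p c) = f.eval w := by
  unfold eval; rw [lift_update_of_coef f w p c hp]

/-- Forms with the same constant and coefficients evaluate equally. [folklore] -/
theorem eval_congr {k : ℕ} {f g : AffForm} (hc : f.c = g.c) (ha : ∀ j, f.coef j = g.coef j)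
    (w : Fin k → Bool) : f.eval w = g.eval w := by
  unfold eval lift
  rw [hc]
  simp only [ha]

/-- Beyond the coefficient list all coefficients vanish. [folklore] -/
theorem coef_eq_false_of_le (f : AffForm) {j : ℕ} (h : f.a.length ≤ j) : f.coef j = false :=
  List.getD_eq_default _ _ h

end AffForm

/-! ### Arithmetic helpers: sums modulo `n`, products of sums -/

/-- Termwise congruent sums are congruent. [folklore] -/
theorem sum_mod_congr {s : Finset ℕ} {f g : ℕ → ℕ} {n : ℕ} (h : ∀ i ∈ s, f i % n = g i % n) :
    (∑ i ∈ s, f i) % n = (∑ i ∈ s, g i) % n := by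
  rw [Finset.sum_nat_mod, Finset.sum_congr rfl h, ← Finset.sum_nat_mod]

/-- `(Σ_{i<k} x_i)(Σ_{j<k} y_j) = Σ_i x_i y_i + Σ_{j<i<k} (x_i y_j + x_j y_i)`. [folklore] -/
theorem sum_mul_sum_range (x y : ℕ → ℕ) (k : ℕ) :
    (∑ i ∈ range k, x i) * (∑ j ∈ range k, y j) =
      ∑ i ∈ range k, x i * y i + ∑ i ∈ range k, ∑ j ∈ range i, (x i * y j + x j * y i) := by
  induction k with
  | zero => simp
  | succ k ih =>
    rw [sum_range_succ, sum_range_succ, sum_range_succ (fun i => x i * y i),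
      sum_range_succ (fun i => ∑ j ∈ range i, (x i * y j + x j * y i)), Finset.sum_add_distrib,
      ← Finset.mul_sum, ← Finset.sum_mul]
    set X := ∑ i ∈ range k, x i
    set Y := ∑ j ∈ range k, y j
    rw [show (X + x k) * (Y + y k) = X * Y + (x k * y k + (x k * Y + X * y k)) by ring, ih]
    ring

/-- `Σ_{i} x_i (Σ_{j<i} x_j) = Σ_i Σ_{j<i} x_i x_j`. [folklore] -/
theorem sum_mul_sum_lt (x : ℕ → ℕ) (k : ℕ) :
    ∑ i ∈ range k, x i * ∑ j ∈ range i, x j = ∑ i ∈ range k, ∑ j ∈ range i, x i * x j :=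
  Finset.sum_congr rfl fun _ _ => Finset.mul_sum _ _ _

/-! ### Padded list arithmetic -/

/-- Reading a tabulated list `[f 0, …, f (n-1)]`. [folklore] -/
theorem getD_map_range {α : Type*} (f : ℕ → α) (n i : ℕ) (d : α) :
    ((List.range n).map f).getD i d = if i < n then f i else d := by
  rw [List.getD_eq_getElem?_getD, List.getElem?_map]
  by_cases h : i < n
  · rw [List.getElem?_range h, if_pos h]; rfl
  · rw [List.getElem?_eq_none (by simpa using Nat.not_lt.1 h), if_neg h]; rfl

/-- Reading a list after overwriting one entry with the default value. [folklore] -/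
theorem getD_set_default {α : Type*} (l : List α) (p j : ℕ) (d : α) :
    (l.set p d).getD j d = if j = p then d else l.getD j d := by
  rw [List.getD_eq_getElem?_getD, List.getElem?_set]
  by_cases h : p = j
  · subst h
    rw [if_pos rfl, if_pos rfl]
    split <;> rfl
  · rw [if_neg h, if_neg (Ne.symm h), List.getD_eq_getElem?_getD]

/-- Reading `List.mapIdx`. [folklore] -/
theorem getD_mapIdx {α β : Type*} (f : ℕ → α → β) (l : List α) (i : ℕ) (d : β) (d' : α) :
    (l.mapIdx f).getD i d = if i < l.length then f i (l.getD i d') else d := by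
  rw [List.getD_eq_getElem?_getD, List.getElem?_mapIdx]
  by_cases h : i < l.length
  · rw [List.getElem?_eq_getElem h, List.getD_eq_getElem _ _ h, if_pos h]; rfl
  · rw [List.getElem?_eq_none (Nat.not_lt.1 h), if_neg h]; rfl

/-- Entrywise sum modulo `4` of two lists of naturals, the shorter padded with `0` (all entries of
the result are reduced modulo `4`). [folklore] -/
def addMod4 : List ℕ → List ℕ → List ℕ
  | [], v => v.map (· % 4)
  | x :: u, [] => (x % 4) :: addMod4 u []
  | x :: u, y :: v => ((x + y) % 4) :: addMod4 u v

/-- `addMod4` is entrywise addition modulo `4`. [folklore] -/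
theorem getD_addMod4 (u v : List ℕ) (j : ℕ) :
    (addMod4 u v).getD j 0 = (u.getD j 0 + v.getD j 0) % 4 := by
  induction u generalizing v j with
  | nil =>
    simp only [addMod4, List.getD_eq_getElem?_getD, List.getElem?_map]
    cases v[j]? <;> simp
  | cons x u ih =>
    cases v with
    | nil =>
      cases j with
      | zero => simp [addMod4]
      | succ j => simp only [addMod4, List.getD_cons_succ, List.getD_nil]; simpa using ih [] j
    | cons y v =>
      cases j with
      | zero => simp [addMod4]
      | succ j => simp only [addMod4, List.getD_cons_succ]; exact ih v j

/-- Length of `addMod4`. [folklore] -/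
theorem length_addMod4 (u v : List ℕ) : (addMod4 u v).length = max u.length v.length := by
  induction u generalizing v with
  | nil => simp [addMod4]
  | cons x u ih =>
    cases v with
    | nil => simp [addMod4, ih]
    | cons y v => simp [addMod4, ih, Nat.succ_max_succ]

/-- Rowwise `bxor` of two ragged matrices, the shorter padded with empty rows. [folklore] -/
def xorRows : List (List Bool) → List (List Bool) → List (List Bool)
  | [], V => V
  | U, [] => U
  | r :: U, s :: V => AffForm.bxor r s :: xorRows U V

/-- `bxor` with the empty list on the right. [folklore] -/
theorem AffForm.bxor_nil_right (u : List Bool) : AffForm.bxor u [] = u := by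
  cases u <;> rfl

/-- `xorRows` is rowwise `bxor`. [folklore] -/
theorem getD_xorRows (U V : List (List Bool)) (i : ℕ) :
    (xorRows U V).getD i [] = AffForm.bxor (U.getD i []) (V.getD i []) := by
  induction U generalizing V i with
  | nil => simp [xorRows, AffForm.bxor]
  | cons r U ih =>
    cases V with
    | nil => simp [xorRows, AffForm.bxor_nil_right]
    | cons s V =>
      cases i with
      | zero => simp [xorRows]
      | succ i => simp only [xorRows, List.getD_cons_succ]; exact ih V i

/-- Length of `xorRows`. [folklore] -/
theorem length_xorRows (U V : List (List Bool)) : (xorRows U V).length = max U.length V.length := by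
  induction U generalizing V with
  | nil => cases V <;> simp [xorRows]
  | cons r U ih =>
    cases V with
    | nil => simp [xorRows]
    | cons s V => simp [xorRows, ih, Nat.succ_max_succ]

/-- The ragged matrix of products `u_i ∧ v_j`, rows `i < |u|`, entries `j < i`. [folklore] -/
def crossRows (u v : List Bool) : List (List Bool) :=
  (List.range u.length).map fun i => (List.range i).map fun j => u.getD i false && v.getD j false

/-- Entries of `crossRows` below the diagonal. [folklore] -/
theorem getD_crossRows (u v : List Bool) {i j : ℕ} (hji : j < i) :
    ((crossRows u v).getD i []).getD j false = (u.getD i false && v.getD j false) := by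
  unfold crossRows
  rw [getD_map_range]
  by_cases hi : i < u.length
  · rw [if_pos hi, getD_map_range, if_pos hji]
  · have hu : u.getD i false = false := List.getD_eq_default _ _ (Nat.not_lt.1 hi)
    rw [if_neg hi, List.getD_nil, hu, Bool.false_and]

/-- Number of rows of `crossRows`. [folklore] -/
@[simp] theorem length_crossRows (u v : List Bool) : (crossRows u v).length = u.length := by
  simp [crossRows]

/-- The scaled coefficient list `(s · [a_j]) mod 4`. [folklore] -/
def scaleList (s : ℕ) (a : List Bool) : List ℕ := a.map fun b => if b then s % 4 else 0

/-- Entries of `scaleList`. [folklore] -/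
theorem getD_scaleList (s : ℕ) (a : List Bool) (j : ℕ) :
    (scaleList s a).getD j 0 = if a.getD j false then s % 4 else 0 := by
  unfold scaleList
  rw [List.getD_eq_getElem?_getD, List.getElem?_map, List.getD_eq_getElem?_getD]
  cases a[j]? <;> simp

/-- Length of `scaleList`. [folklore] -/
@[simp] theorem length_scaleList (s : ℕ) (a : List Bool) : (scaleList s a).length = a.length := by
  simp [scaleList]

/-! ### The data `(μ, Λ, B)` of a quadratic-form exponential sum and its value -/

/-- The data of an exponential sum `Σ_w i^{μ + Σ_j Λ_j w_j} (−1)^{Σ_{j<l} B_{lj} w_l w_j}`: `μ ∈ ℤ₄`,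
the list `Λ`, and the ragged lower-triangular matrix `B` (row `l` lists the couplings `B_{lj}`,
`j < l`). Entries beyond the end of a list read as `0`. [cite: BravyiGosset2016, App. A (eq. (qform3))] -/
structure GData where
  /-- The constant phase exponent `μ` (of `i`). -/
  mu : ℕ
  /-- The linear phase exponents `Λ_j` (of `i`). -/
  lam : List ℕ
  /-- The quadratic couplings: row `l`, entry `j < l` is `B_{lj}` (exponent of `−1`). -/
  B : List (List Bool)
  deriving DecidableEq, Inhabited

namespace GData

/-- `Λ_j` (`0` beyond the end). [folklore] -/
def lamAt (D : GData) (j : ℕ) : ℕ := D.lam.getD j 0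

/-- `B_{lj}` (`false` beyond the ends). [folklore] -/
def entry (D : GData) (l j : ℕ) : Bool := (D.B.getD l []).getD j false

/-- The exponent of `i`: `μ + Σ_{j<k} Λ_j [w_j]`. [folklore] -/
def expI {k : ℕ} (D : GData) (w : Fin k → Bool) : ℕ :=
  D.mu + ∑ j ∈ range k, D.lamAt j * Bool.toNat (wbit w j)

/-- The exponent of `−1`: `Σ_{l<k} Σ_{j<l} [B_{lj} ∧ w_l ∧ w_j]`. [folklore] -/
def expNeg {k : ℕ} (D : GData) (w : Fin k → Bool) : ℕ :=
  ∑ l ∈ range k, ∑ j ∈ range l, Bool.toNat (D.entry l j && wbit w l && wbit w j)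

/-- **The summand** `i^{μ + Λ·w} (−1)^{B(w)}` at a valuation of `k` ambient variables.
[cite: BravyiGosset2016, App. A] -/
noncomputable def val (k : ℕ) (D : GData) (w : Fin k → Bool) : ℂ :=
  I ^ D.expI w * (-1 : ℂ) ^ D.expNeg w

/-- **The exponential sum** `Γ_k(D) = Σ_{w ∈ 𝔽₂^k} i^{μ + Λ·w} (−1)^{B(w)}`.
[cite: BravyiGosset2016, App. A] -/
noncomputable def gsum (k : ℕ) (D : GData) : ℂ := ∑ w : Fin k → Bool, D.val k w

/-- The value only depends on the exponents modulo `4` and `2`. [folklore] -/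
theorem val_eq_of_mod {k : ℕ} (D : GData) (w : Fin k → Bool) {a q : ℕ} (ha : a % 4 = D.expI w % 4)
    (hq : q % 2 = D.expNeg w % 2) : D.val k w = I ^ a * (-1 : ℂ) ^ q := by
  unfold val
  rw [I_pow_eq_of_mod_eq ha, neg_one_pow_eq_of_mod_eq hq]

/-- Two data with congruent exponents at `w` have the same value at `w`. [folklore] -/
theorem val_congr {k : ℕ} {D D' : GData} {w : Fin k → Bool} (ha : D'.expI w % 4 = D.expI w % 4)
    (hq : D'.expNeg w % 2 = D.expNeg w % 2) : D'.val k w = D.val k w :=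
  (D.val_eq_of_mod w ha hq).symm ▸ rfl

/-! ### Adding a constant phase -/

/-- Multiply by `i^e`: `μ ↦ μ + e`. [folklore] -/
def addMu (e : ℕ) (D : GData) : GData := ⟨(D.mu + e) % 4, D.lam, D.B⟩

/-- `val (addMu e D) = i^e · val D`. [folklore] -/
theorem val_addMu {k : ℕ} (e : ℕ) (D : GData) (w : Fin k → Bool) :
    (addMu e D).val k w = D.val k w * I ^ e := by
  have ha : (D.expI w + e) % 4 = (addMu e D).expI w % 4 := by
    unfold expI addMu lamAt
    simp only
    omega
  rw [(addMu e D).val_eq_of_mod w ha (rfl : D.expNeg w % 2 = (addMu e D).expNeg w % 2), pow_add]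
  unfold val
  ring

/-! ### Multiplying by `i^{κ [f(w)]}` -/

/-- **`addPhaseForm κ f D`**: the data of `val D · i^{κ [f(w)]}` for an affine form
`f = c ⊕ ⊕ a_j w_j`. By the parity identity, `i^{[f(w)]} = i^{c + (1 + 2c) Σ_j a_j w_j} (−1)^{Σ_{j<l} a_j a_l w_j w_l}`,
so `μ += κ c`, `Λ_j += κ (1 + 2c) a_j`, and, for odd `κ`, `B_{lj} ⊕= a_l a_j`.
[cite: BravyiGosset2016, App. A] -/
def addPhaseForm (κ : ℕ) (f : AffForm) (D : GData) : GData where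
  mu := (D.mu + κ * Bool.toNat f.c) % 4
  lam := addMod4 D.lam (scaleList (κ * (1 + 2 * Bool.toNat f.c)) f.a)
  B := if κ % 2 = 1 then xorRows D.B (crossRows f.a f.a) else D.B

/-- The `i`-exponent of `addPhaseForm`, modulo `4`. [folklore] -/
theorem expI_addPhaseForm_mod {k : ℕ} (κ : ℕ) (f : AffForm) (D : GData) (w : Fin k → Bool) :
    (addPhaseForm κ f D).expI w % 4 =
      (D.expI w + κ * Bool.toNat f.c +
        κ * (1 + 2 * Bool.toNat f.c) * ∑ j ∈ range k, Bool.toNat (f.coef j && wbit w j)) % 4 := by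
  have hsum : (∑ j ∈ range k, (addPhaseForm κ f D).lamAt j * Bool.toNat (wbit w j)) % 4 =
      (∑ j ∈ range k, (D.lamAt j * Bool.toNat (wbit w j) +
        κ * (1 + 2 * Bool.toNat f.c) * Bool.toNat (f.coef j && wbit w j))) % 4 := by
    apply sum_mod_congr
    intro j _
    unfold lamAt addPhaseForm
    rw [getD_addMod4, getD_scaleList]
    change (D.lam.getD j 0 + (if f.coef j then _ else 0)) % 4 * _ % 4 = _
    cases f.coef j <;> cases wbit w j <;> simp [Nat.mul_mod, Nat.add_mod]
  rw [Finset.sum_add_distrib, ← Finset.mul_sum] at hsum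
  unfold expI
  generalize (∑ j ∈ range k, (addPhaseForm κ f D).lamAt j * Bool.toNat (wbit w j)) = S' at hsum ⊢
  generalize κ * (1 + 2 * Bool.toNat f.c) * ∑ i ∈ range k, Bool.toNat (f.coef i && wbit w i) = P at hsum ⊢
  have hmu : (addPhaseForm κ f D).mu = (D.mu + κ * Bool.toNat f.c) % 4 := rfl
  rw [hmu]
  omega

/-- The `−1`-exponent of `addPhaseForm`, modulo `2`. [folklore] -/
theorem expNeg_addPhaseForm_mod {k : ℕ} (κ : ℕ) (f : AffForm) (D : GData) (w : Fin k → Bool) :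
    (addPhaseForm κ f D).expNeg w % 2 =
      (D.expNeg w + κ * ∑ l ∈ range k, ∑ j ∈ range l,
        Bool.toNat (f.coef l && wbit w l) * Bool.toNat (f.coef j && wbit w j)) % 2 := by
  unfold expNeg addPhaseForm entry
  rcases Nat.mod_two_eq_zero_or_one κ with hκ | hκ
  · simp only [hκ, zero_ne_one, if_false]
    rw [Nat.add_mod, Nat.mul_mod, hκ]; simp
  · simp only [hκ, if_true]
    rw [Finset.mul_sum, ← Finset.sum_add_distrib]
    apply sum_mod_congr
    intro l _
    rw [Finset.mul_sum, ← Finset.sum_add_distrib]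
    apply sum_mod_congr
    intro j hj
    rw [getD_xorRows, AffForm.getD_bxor, getD_crossRows _ _ (Finset.mem_range.1 hj), Nat.add_mod,
      Nat.mul_mod, hκ]
    change Bool.toNat (((D.B.getD l []).getD j false ^^ (f.coef l && f.coef j)) && wbit w l && wbit w j) % 2 = _
    cases (D.B.getD l []).getD j false <;> cases f.coef l <;> cases f.coef j <;> cases wbit w l <;>
      cases wbit w j <;> rfl

/-- The phase `i^{[f(w)]}` of an affine form in the shape `i^{linear} (−1)^{quadratic}`:
`i^{[f(w)]} = i^{c + (1+2c) X} (−1)^{E}` with `X = Σ_j [a_j w_j]`, `E = Σ_{j<l} [a_l w_l][a_j w_j]`.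
[cite: BravyiGosset2016, App. A] -/
theorem I_pow_toNat_eval {k : ℕ} (f : AffForm) (w : Fin k → Bool) :
    I ^ Bool.toNat (f.eval w) =
      I ^ (Bool.toNat f.c + (1 + 2 * Bool.toNat f.c) * ∑ j ∈ range k, Bool.toNat (f.coef j && wbit w j)) *
        (-1 : ℂ) ^ (∑ l ∈ range k, ∑ j ∈ range l,
          Bool.toNat (f.coef l && wbit w l) * Bool.toNat (f.coef j && wbit w j)) := by
  set x : ℕ → ℕ := fun j => Bool.toNat (f.coef j && wbit w j) with hx
  have hx1 : ∀ j, x j ≤ 1 := fun j => Bool.toNat_le _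
  have hpar := I_pow_mod_two_eq x hx1 k
  rw [sum_mul_sum_lt] at hpar
  have heval : Bool.toNat (f.eval w) = (Bool.toNat f.c + ∑ j ∈ range k, x j) % 2 := by
    unfold AffForm.eval AffForm.lift
    exact toNat_decide_mod_two _
  rw [heval]
  set X := ∑ j ∈ range k, x j
  set E := ∑ l ∈ range k, ∑ j ∈ range l, x l * x j
  cases f.c
  · simp only [Bool.toNat_false, zero_add, mul_zero, add_zero, one_mul]
    exact hpar
  · simp only [Bool.toNat_true, mul_one]
    -- `i^{(1+X) mod 2} = i · i^{X mod 2} · (-1)^X`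
    have h1 : I ^ ((1 + X) % 2) = I * I ^ (X % 2) * (-1 : ℂ) ^ X := by
      rcases Nat.mod_two_eq_zero_or_one X with he | ho
      · rw [show (1 + X) % 2 = 1 by omega, he, neg_one_pow_eq_pow_mod_two X, he]; simp
      · rw [show (1 + X) % 2 = 0 by omega, ho, neg_one_pow_eq_pow_mod_two X, ho]
        simp only [pow_zero, pow_one, mul_neg, mul_one, Complex.I_mul_I, neg_neg]
    rw [h1, hpar, show 1 + (1 + 2) * X = 1 + X + 2 * X by ring, pow_add, pow_add, pow_one,
      I_pow_two_mul]
    ring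

/-- **Value of `addPhaseForm`**: `val (addPhaseForm κ f D) = val D · (i^{[f(w)]})^κ`.
[cite: BravyiGosset2016, App. A] -/
theorem val_addPhaseForm {k : ℕ} (κ : ℕ) (f : AffForm) (D : GData) (w : Fin k → Bool) :
    (addPhaseForm κ f D).val k w = D.val k w * (I ^ Bool.toNat (f.eval w)) ^ κ := by
  set X := ∑ j ∈ range k, Bool.toNat (f.coef j && wbit w j) with hX
  set E := ∑ l ∈ range k, ∑ j ∈ range l, Bool.toNat (f.coef l && wbit w l) * Bool.toNat (f.coef j && wbit w j)
    with hE
  have ha := expI_addPhaseForm_mod κ f D w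
  have hq := expNeg_addPhaseForm_mod κ f D w
  rw [(addPhaseForm κ f D).val_eq_of_mod w ha.symm hq.symm, I_pow_toNat_eval, ← hX, ← hE]
  unfold val
  rw [mul_pow, ← pow_mul, ← pow_mul, pow_add, pow_add, pow_add]
  have e1 : I ^ (κ * Bool.toNat f.c) * I ^ (κ * (1 + 2 * Bool.toNat f.c) * X) =
      I ^ ((Bool.toNat f.c + (1 + 2 * Bool.toNat f.c) * X) * κ) := by
    rw [← pow_add]; congr 1; ring
  have e2 : (-1 : ℂ) ^ (κ * E) = (-1 : ℂ) ^ (E * κ) := by rw [mul_comm]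
  rw [e2, mul_assoc (I ^ D.expI w), e1]
  ring

/-! ### Multiplying by `(−1)^{[f(w)] [g(w)]}` -/

/-- The linear corrections of `addQuadProduct`: `2 ([c] b_j + [d] a_j + a_j b_j) mod 4`. [folklore] -/
def quadLin (f g : AffForm) : List ℕ :=
  (List.range (max f.a.length g.a.length)).map fun j =>
    2 * (Bool.toNat (f.c && g.coef j) + Bool.toNat (g.c && f.coef j) + Bool.toNat (f.coef j && g.coef j)) % 4

/-- Entries of `quadLin`. [folklore] -/
theorem getD_quadLin (f g : AffForm) (j : ℕ) :
    (quadLin f g).getD j 0 =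
      2 * (Bool.toNat (f.c && g.coef j) + Bool.toNat (g.c && f.coef j) + Bool.toNat (f.coef j && g.coef j)) % 4 := by
  unfold quadLin
  rw [getD_map_range]
  by_cases hj : j < max f.a.length g.a.length
  · rw [if_pos hj]
  · rw [if_neg hj]
    have hf : f.coef j = false := f.coef_eq_false_of_le (le_of_max_le_left (Nat.not_lt.1 hj))
    have hg : g.coef j = false := g.coef_eq_false_of_le (le_of_max_le_right (Nat.not_lt.1 hj))
    simp [hf, hg]

/-- **`addQuadProduct f g D`**: the data of `val D · (−1)^{[f(w)][g(w)]}`. Expanding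
`(c + Σ a_j w_j)(d + Σ b_j w_j)` modulo `2`: `μ += 2cd`, `Λ_j += 2(c b_j + d a_j + a_j b_j)`,
`B_{lj} ⊕= a_l b_j ⊕ a_j b_l`. [cite: BravyiGosset2016, App. A] -/
def addQuadProduct (f g : AffForm) (D : GData) : GData where
  mu := (D.mu + 2 * Bool.toNat (f.c && g.c)) % 4
  lam := addMod4 D.lam (quadLin f g)
  B := xorRows D.B (xorRows (crossRows f.a g.a) (crossRows g.a f.a))

/-- The `i`-exponent of `addQuadProduct`, modulo `4`. [folklore] -/
theorem expI_addQuadProduct_mod {k : ℕ} (f g : AffForm) (D : GData) (w : Fin k → Bool) :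
    (addQuadProduct f g D).expI w % 4 =
      (D.expI w + 2 * (Bool.toNat (f.c && g.c) +
        ∑ j ∈ range k, (Bool.toNat (f.c && g.coef j && wbit w j) + Bool.toNat (g.c && f.coef j && wbit w j) +
          Bool.toNat (f.coef j && wbit w j) * Bool.toNat (g.coef j && wbit w j)))) % 4 := by
  have hsum : (∑ j ∈ range k, (addQuadProduct f g D).lamAt j * Bool.toNat (wbit w j)) % 4 =
      (∑ j ∈ range k, (D.lamAt j * Bool.toNat (wbit w j) +
        2 * (Bool.toNat (f.c && g.coef j && wbit w j) + Bool.toNat (g.c && f.coef j && wbit w j) +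
          Bool.toNat (f.coef j && wbit w j) * Bool.toNat (g.coef j && wbit w j)))) % 4 := by
    apply sum_mod_congr
    intro j _
    unfold lamAt addQuadProduct
    rw [getD_addMod4, getD_quadLin]
    cases f.c <;> cases g.c <;> cases f.coef j <;> cases g.coef j <;> cases wbit w j <;>
      simp [Nat.add_mod]
  rw [Finset.sum_add_distrib, ← Finset.mul_sum] at hsum
  unfold expI
  generalize (∑ j ∈ range k, (addQuadProduct f g D).lamAt j * Bool.toNat (wbit w j)) = S' at hsum ⊢
  generalize (∑ j ∈ range k, (Bool.toNat (f.c && g.coef j && wbit w j) + Bool.toNat (g.c && f.coef j && wbit w j) +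
    Bool.toNat (f.coef j && wbit w j) * Bool.toNat (g.coef j && wbit w j))) = P at hsum ⊢
  have hmu : (addQuadProduct f g D).mu = (D.mu + 2 * Bool.toNat (f.c && g.c)) % 4 := rfl
  rw [hmu]
  omega

/-- The `−1`-exponent of `addQuadProduct`, modulo `2`. [folklore] -/
theorem expNeg_addQuadProduct_mod {k : ℕ} (f g : AffForm) (D : GData) (w : Fin k → Bool) :
    (addQuadProduct f g D).expNeg w % 2 =
      (D.expNeg w + ∑ l ∈ range k, ∑ j ∈ range l,
        (Bool.toNat (f.coef l && wbit w l) * Bool.toNat (g.coef j && wbit w j) +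
          Bool.toNat (f.coef j && wbit w j) * Bool.toNat (g.coef l && wbit w l))) % 2 := by
  unfold expNeg addQuadProduct entry
  simp only
  rw [← Finset.sum_add_distrib]
  apply sum_mod_congr
  intro l _
  rw [← Finset.sum_add_distrib]
  apply sum_mod_congr
  intro j hj
  have hjl := Finset.mem_range.1 hj
  rw [getD_xorRows, AffForm.getD_bxor, getD_xorRows, AffForm.getD_bxor, getD_crossRows _ _ hjl,
    getD_crossRows _ _ hjl]
  change Bool.toNat (((D.B.getD l []).getD j false ^^ (f.coef l && g.coef j ^^ (g.coef l && f.coef j))) &&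
    wbit w l && wbit w j) % 2 = _
  cases (D.B.getD l []).getD j false <;> cases f.coef l <;> cases f.coef j <;> cases g.coef l <;>
    cases g.coef j <;> cases wbit w l <;> cases wbit w j <;> rfl

/-- `(−1)^{[f(w)][g(w)]} = (−1)^{lift f · lift g}`. [folklore] -/
theorem neg_one_pow_toNat_eval_mul {k : ℕ} (f g : AffForm) (w : Fin k → Bool) :
    (-1 : ℂ) ^ Bool.toNat (f.eval w && g.eval w) = (-1 : ℂ) ^ (f.lift w * g.lift w) := by
  apply neg_one_pow_eq_of_mod_eq
  unfold AffForm.eval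
  rw [Nat.mul_mod]
  rcases Nat.mod_two_eq_zero_or_one (f.lift w) with h1 | h1 <;>
    rcases Nat.mod_two_eq_zero_or_one (g.lift w) with h2 | h2 <;> simp [h1, h2]

/-- **Value of `addQuadProduct`**: `val (addQuadProduct f g D) = val D · (−1)^{[f(w)][g(w)]}`.
[cite: BravyiGosset2016, App. A] -/
theorem val_addQuadProduct {k : ℕ} (f g : AffForm) (D : GData) (w : Fin k → Bool) :
    (addQuadProduct f g D).val k w = D.val k w * (-1 : ℂ) ^ Bool.toNat (f.eval w && g.eval w) := by
  set x : ℕ → ℕ := fun j => Bool.toNat (f.coef j && wbit w j) with hx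
  set y : ℕ → ℕ := fun j => Bool.toNat (g.coef j && wbit w j) with hy
  have ha := expI_addQuadProduct_mod f g D w
  have hq := expNeg_addQuadProduct_mod f g D w
  rw [(addQuadProduct f g D).val_eq_of_mod w ha.symm hq.symm, neg_one_pow_toNat_eval_mul]
  unfold val AffForm.lift
  -- expand the product of the two lifts
  have hprod : (Bool.toNat f.c + ∑ j ∈ range k, x j) * (Bool.toNat g.c + ∑ j ∈ range k, y j) =
      Bool.toNat f.c * Bool.toNat g.c + Bool.toNat f.c * ∑ j ∈ range k, y j + Bool.toNat g.c * ∑ j ∈ range k, x j +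
        (∑ i ∈ range k, x i * y i + ∑ i ∈ range k, ∑ j ∈ range i, (x i * y j + x j * y i)) := by
    rw [← sum_mul_sum_range]; ring
  have hc1 : ∀ j, Bool.toNat (f.c && g.coef j && wbit w j) = Bool.toNat f.c * y j := fun j => by
    simp only [hy]; cases f.c <;> cases g.coef j <;> cases wbit w j <;> rfl
  have hc2 : ∀ j, Bool.toNat (g.c && f.coef j && wbit w j) = Bool.toNat g.c * x j := fun j => by
    simp only [hx]; cases g.c <;> cases f.coef j <;> cases wbit w j <;> rfl
  simp only [hc1, hc2, toNat_and f.c g.c]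
  change I ^ (D.expI w + 2 * (Bool.toNat f.c * Bool.toNat g.c + ∑ j ∈ range k, (Bool.toNat f.c * y j + Bool.toNat g.c * x j +
      x j * y j))) * (-1 : ℂ) ^ (D.expNeg w + ∑ l ∈ range k, ∑ j ∈ range l, (x l * y j + x j * y l)) =
    I ^ D.expI w * (-1 : ℂ) ^ D.expNeg w *
      (-1 : ℂ) ^ ((Bool.toNat f.c + ∑ j ∈ range k, x j) * (Bool.toNat g.c + ∑ j ∈ range k, y j))
  rw [hprod, pow_add, I_pow_two_mul, pow_add (-1 : ℂ) (D.expNeg w), Finset.sum_add_distrib,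
    Finset.sum_add_distrib, ← Finset.mul_sum, ← Finset.mul_sum]
  simp only [pow_add]
  ring

/-! ### Zeroing a variable and separating its contribution -/

/-- Couplings of variable `p` to the other variables `j < k`, as the linear form
`Σ_{j<p} B_{pj} w_j + Σ_{p<l<k} B_{lp} w_l` (no constant, no `w_p`). [folklore] -/
def colrow (k p : ℕ) (D : GData) : AffForm :=
  ⟨false, (List.range k).map fun j => if j < p then D.entry p j else if j = p then false else D.entry j p⟩

/-- Coefficients of `colrow`. [folklore] -/
theorem coef_colrow (k p : ℕ) (D : GData) (j : ℕ) :
    (colrow k p D).coef j =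
      if j < k then (if j < p then D.entry p j else if j = p then false else D.entry j p) else false := by
  unfold colrow AffForm.coef
  exact getD_map_range _ _ _ _

/-- `zeroVar p D`: remove every occurrence of the variable `w_p` (`Λ_p := 0`, row `p` emptied,
entry `p` of the later rows cleared). [folklore] -/
def zeroVar (p : ℕ) (D : GData) : GData where
  mu := D.mu
  lam := D.lam.set p 0
  B := D.B.mapIdx fun l row => if l = p then [] else if p < l then row.set p false else row

/-- `Λ` of `zeroVar`. [folklore] -/
theorem lamAt_zeroVar (p : ℕ) (D : GData) (j : ℕ) :
    (zeroVar p D).lamAt j = if j = p then 0 else D.lamAt j := by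
  unfold zeroVar lamAt
  exact getD_set_default _ _ _ _

/-- Entries of `zeroVar` below the diagonal. [folklore] -/
theorem entry_zeroVar (p : ℕ) (D : GData) {l j : ℕ} (hjl : j < l) :
    (zeroVar p D).entry l j = if l = p ∨ j = p then false else D.entry l j := by
  unfold zeroVar entry
  simp only
  rw [getD_mapIdx _ _ _ _ []]
  by_cases hl : l < D.B.length
  · rw [if_pos hl]
    by_cases hlp : l = p
    · simp [hlp]
    · rw [if_neg hlp]
      rcases lt_or_gt_of_ne (Ne.symm hlp) with hpl | hpl
      · rw [if_pos hpl, getD_set_default]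
        by_cases hjp : j = p
        · simp [hjp]
        · simp [hlp, hjp]
      · have hjp : j ≠ p := fun h => by omega
        rw [if_neg (Nat.not_lt.2 hpl.le)]
        simp [hlp, hjp]
  · rw [if_neg hl, List.getD_nil, List.getD_eq_default _ _ (Nat.not_lt.1 hl), List.getD_nil]
    simp

/-- **Separating one variable.** For `p < k`: the value at `w[p ↦ u]` is the value at `w[p ↦ 0]`
times `i^{Λ_p [u]} (−1)^{[u] · colrow_p(w)}`. [folklore] -/
theorem val_update {k : ℕ} (D : GData) (w : Fin k → Bool) (p : Fin k) (u : Bool) :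
    D.val k (Function.update w p u) =
      D.val k (Function.update w p false) * I ^ (D.lamAt p * Bool.toNat u) *
        (-1 : ℂ) ^ Bool.toNat (u && (colrow k p D).eval w) := by
  -- the `i`-exponent
  have hA : D.expI (Function.update w p u) = D.expI (Function.update w p false) + D.lamAt p * Bool.toNat u := by
    unfold expI
    rw [add_assoc, ← Finset.sum_erase_add _ _ (Finset.mem_range.2 p.2),
      ← Finset.sum_erase_add (range k) _ (Finset.mem_range.2 p.2), add_assoc]
    congr 1
    congr 1
    · refine Finset.sum_congr rfl fun j hj => ?_
      rw [wbit_update, wbit_update, if_neg (Finset.ne_of_mem_erase hj), if_neg (Finset.ne_of_mem_erase hj)]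
    · rw [wbit_update, wbit_update, if_pos rfl, if_pos rfl]; simp
  -- the `−1`-exponent: split the terms touching `p`
  have hterm : ∀ (v : Bool) (l j : ℕ), j < l →
      Bool.toNat (D.entry l j && wbit (Function.update w p v) l && wbit (Function.update w p v) j) =
        Bool.toNat (D.entry l j && wbit (Function.update w p false) l && wbit (Function.update w p false) j) +
          Bool.toNat v * (Bool.toNat (decide (l = p) && D.entry l j && wbit w j) +
            Bool.toNat (decide (j = p) && D.entry l j && wbit w l)) := by
    intro v l j hjl
    simp only [wbit_update]
    by_cases hl : l = (p : ℕ)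
    · subst hl
      have hj : j ≠ (p : ℕ) := Nat.ne_of_lt hjl
      simp only [decide_true, Bool.true_and, hj, decide_false, Bool.false_and,
        Bool.toNat_false, add_zero, if_true, if_false]
      cases v <;> cases D.entry p j <;> cases wbit w j <;> rfl
    · by_cases hj : j = (p : ℕ)
      · subst hj
        simp only [hl, decide_false, Bool.false_and, Bool.toNat_false, zero_add,
          decide_true, Bool.true_and, if_true, if_false]
        cases v <;> cases D.entry l p <;> cases wbit w l <;> rfl
      · simp [hl, hj]
  have hQ : D.expNeg (Function.update w p u) =
      D.expNeg (Function.update w p false) + Bool.toNat u * (colrow k p D).lift w := by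
    unfold expNeg
    rw [Finset.sum_congr rfl fun l _ => Finset.sum_congr rfl fun j hj =>
      hterm u l j (Finset.mem_range.1 hj)]
    simp only [Finset.sum_add_distrib, ← Finset.mul_sum]
    congr 1
    congr 1
    unfold AffForm.lift
    have hc0 : (colrow k p D).c = false := rfl
    simp only [hc0, Bool.toNat_false, zero_add]
    rw [Finset.sum_comm' (t' := range k) (s' := fun j => Finset.Ioo j k)
      (h := fun l j => by simp only [Finset.mem_range, Finset.mem_Ioo]; omega)]
    rw [← Finset.sum_add_distrib]
    refine Finset.sum_congr rfl fun j hj => ?_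
    have hjk := Finset.mem_range.1 hj
    rw [coef_colrow, if_pos hjk]
    rcases Nat.lt_trichotomy j p with hjp | hjp | hjp
    · -- `j < p`: only the term `l = p` of the first sum survives
      rw [if_pos hjp, Finset.sum_eq_single_of_mem (p : ℕ) (Finset.mem_Ioo.2 ⟨hjp, p.2⟩),
        Finset.sum_eq_zero]
      · simp only [decide_true, Bool.true_and, add_zero]
      · intro l hl
        have hlp : l ≠ (p : ℕ) := Nat.ne_of_lt (lt_trans (Finset.mem_range.1 hl) hjp)
        simp [hlp]
      · intro l _ hlp; simp [hlp]
    · subst hjp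
      rw [if_neg (lt_irrefl _), if_pos rfl, Finset.sum_eq_zero, Finset.sum_eq_zero]
      · simp
      · intro l hl; simp [Nat.ne_of_lt (Finset.mem_range.1 hl)]
      · intro l hl; simp [(Finset.mem_Ioo.1 hl).1.ne']
    · rw [if_neg (Nat.not_lt.2 hjp.le), if_neg (Nat.ne_of_gt hjp), Finset.sum_eq_zero,
        Finset.sum_eq_single_of_mem (p : ℕ) (Finset.mem_range.2 hjp)]
      · simp only [decide_true, Bool.true_and, zero_add]
      · intro l _ hlp; simp [hlp]
      · intro l hl; simp [Nat.ne_of_gt (lt_trans hjp (Finset.mem_Ioo.1 hl).1)]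
  unfold val
  rw [hA, hQ, pow_add, pow_add]
  have hlast : (-1 : ℂ) ^ (Bool.toNat u * (colrow k p D).lift w) = (-1 : ℂ) ^ Bool.toNat (u && (colrow k p D).eval w) := by
    apply neg_one_pow_eq_of_mod_eq
    unfold AffForm.eval
    cases u
    · simp
    · simp only [Bool.toNat_true, one_mul, Bool.true_and]
      rw [toNat_decide_mod_two, Nat.mod_mod]
  rw [hlast]
  ring

/-- The value of `zeroVar p D` is the value of `D` with `w_p := 0`. [folklore] -/
theorem val_zeroVar {k : ℕ} (D : GData) (w : Fin k → Bool) (p : Fin k) :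
    (zeroVar p D).val k w = D.val k (Function.update w p false) := by
  unfold val expI expNeg
  congr 2
  · congr 1
    refine Finset.sum_congr rfl fun j _ => ?_
    rw [lamAt_zeroVar, wbit_update]
    by_cases hj : j = (p : ℕ)
    · simp [hj]
    · rw [if_neg hj, if_neg hj]
  · refine Finset.sum_congr rfl fun l _ => Finset.sum_congr rfl fun j hj => ?_
    rw [entry_zeroVar _ _ (Finset.mem_range.1 hj), wbit_update, wbit_update]
    by_cases hl : l = (p : ℕ)
    · simp [hl]
    · by_cases hj' : j = (p : ℕ)
      · simp [hj']
      · simp [hl, hj']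

/-! ### Restricting to the first `k` variables -/

/-- Reading a truncated list. [folklore] -/
theorem _root_.Literature.Computability.QuantumComplexity.BravyiGosset.getD_take {α : Type*}
    (l : List α) (k j : ℕ) (d : α) : (l.take k).getD j d = if j < k then l.getD j d else d := by
  rw [List.getD_eq_getElem?_getD]
  by_cases h : j < k
  · rw [List.getElem?_take_of_lt h, if_pos h, List.getD_eq_getElem?_getD]
  · rw [if_neg h, List.getElem?_eq_none]
    · rfl
    · simp only [List.length_take]; omega

/-- Keep only the data of the variables `< k` (shape hygiene; the value at `k` ambient variables
is unchanged, `val_restrict`). [folklore] -/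
def restrict (k : ℕ) (D : GData) : GData := ⟨D.mu % 4, D.lam.take k, D.B.take k⟩

/-- `Λ` of `restrict`. [folklore] -/
theorem lamAt_restrict (k : ℕ) (D : GData) (j : ℕ) :
    (restrict k D).lamAt j = if j < k then D.lamAt j else 0 := by
  unfold restrict lamAt; exact getD_take _ _ _ _

/-- Entries of `restrict`. [folklore] -/
theorem entry_restrict (k : ℕ) (D : GData) (l j : ℕ) :
    (restrict k D).entry l j = if l < k then D.entry l j else false := by
  unfold restrict entry
  simp only
  rw [getD_take]
  split <;> simp

/-- Restriction does not change the value at `k` ambient variables. [folklore] -/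
theorem val_restrict (k : ℕ) (D : GData) (w : Fin k → Bool) : (restrict k D).val k w = D.val k w := by
  apply val_congr
  · unfold expI
    rw [Finset.sum_congr rfl fun j hj => by rw [lamAt_restrict, if_pos (Finset.mem_range.1 hj)]]
    show (D.mu % 4 + _) % 4 = _
    omega
  · unfold expNeg
    rw [Finset.sum_congr rfl fun l hl => Finset.sum_congr rfl fun j _ => by
      rw [entry_restrict, if_pos (Finset.mem_range.1 hl)]]

/-! ### The last variable -/

/-- The couplings `B_{kj}`, `j < k`, of the variable `k` as a linear form. [folklore] -/
def lastForm (k : ℕ) (D : GData) : AffForm := ⟨false, (List.range k).map fun j => D.entry k j⟩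

/-- Coefficients of `lastForm`. [folklore] -/
theorem coef_lastForm (k : ℕ) (D : GData) (j : ℕ) :
    (lastForm k D).coef j = if j < k then D.entry k j else false := getD_map_range _ _ _ _

/-- **Splitting off the last variable**: at `k + 1` ambient variables,
`val D (w, c) = val D w · i^{Λ_k [c]} · (−1)^{[c] · B_k(w)}`. [folklore] -/
theorem val_snoc {k : ℕ} (D : GData) (w : Fin k → Bool) (c : Bool) :
    D.val (k + 1) (Fin.snoc w c) =
      D.val k w * I ^ (D.lamAt k * Bool.toNat c) * (-1 : ℂ) ^ Bool.toNat (c && (lastForm k D).eval w) := by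
  have hA : D.expI (Fin.snoc w c : Fin (k + 1) → Bool) = D.expI w + D.lamAt k * Bool.toNat c := by
    unfold expI
    rw [Finset.sum_range_succ, wbit_snoc, if_pos rfl, add_assoc]
    congr 2
    refine Finset.sum_congr rfl fun j hj => ?_
    rw [wbit_snoc, if_neg (Nat.ne_of_lt (Finset.mem_range.1 hj))]
  have hQ : D.expNeg (Fin.snoc w c : Fin (k + 1) → Bool) = D.expNeg w + Bool.toNat c * (lastForm k D).lift w := by
    unfold expNeg
    rw [Finset.sum_range_succ]
    congr 1
    · refine Finset.sum_congr rfl fun l hl => Finset.sum_congr rfl fun j hj => ?_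
      have hlk := Finset.mem_range.1 hl
      have hjk : j < k := lt_trans (Finset.mem_range.1 hj) hlk
      rw [wbit_snoc, wbit_snoc, if_neg (Nat.ne_of_lt hlk), if_neg (Nat.ne_of_lt hjk)]
    · unfold AffForm.lift
      simp only [lastForm, Bool.toNat_false, zero_add, Finset.mul_sum]
      refine Finset.sum_congr rfl fun j hj => ?_
      have hjk := Finset.mem_range.1 hj
      rw [wbit_snoc, wbit_snoc, if_pos rfl, if_neg (Nat.ne_of_lt hjk),
        show AffForm.coef ⟨false, (List.range k).map fun j => D.entry k j⟩ j = D.entry k j by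
          rw [← lastForm, coef_lastForm, if_pos hjk]]
      cases c <;> cases D.entry k j <;> cases wbit w j <;> rfl
  unfold val
  rw [hA, hQ, pow_add, pow_add]
  have hlast : (-1 : ℂ) ^ (Bool.toNat c * (lastForm k D).lift w) = (-1 : ℂ) ^ Bool.toNat (c && (lastForm k D).eval w) := by
    apply neg_one_pow_eq_of_mod_eq
    unfold AffForm.eval
    cases c
    · simp
    · simp only [Bool.toNat_true, one_mul, Bool.true_and]
      rw [toNat_decide_mod_two, Nat.mod_mod]
  rw [hlast]
  ring

/-- Summing the last variable out: `Σ_c val D (w, c) = val D w · (1 + i^{Λ_k} (−1)^{B_k(w)})`.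
[cite: BravyiGosset2016, App. A] -/
theorem val_snoc_false_add_true {k : ℕ} (D : GData) (w : Fin k → Bool) :
    D.val (k + 1) (Fin.snoc w false) + D.val (k + 1) (Fin.snoc w true) =
      D.val k w * (1 + I ^ D.lamAt k * (-1 : ℂ) ^ Bool.toNat ((lastForm k D).eval w)) := by
  rw [val_snoc, val_snoc]
  simp only [Bool.toNat_false, mul_zero, pow_zero, Bool.false_and, mul_one, Bool.toNat_true, Bool.true_and]
  ring

end GData

/-! ### Multipliers and Gaussian integers -/

/-- The multiplier produced by one elimination step: `0`, `1`, `2` or `1 + i`. [folklore] -/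
inductive Mult
  | zero
  | one
  | two
  | onePlusI
  deriving DecidableEq, Inhabited

/-- The complex value of a multiplier. [folklore] -/
noncomputable def Mult.toC : Mult → ℂ
  | .zero => 0
  | .one => 1
  | .two => 2
  | .onePlusI => 1 + I

/-- A multiplier as a Gaussian integer (Mathlib's `GaussianInt = ℤ√(-1)`). [folklore] -/
def Mult.toZi : Mult → GaussianInt
  | .zero => 0
  | .one => 1
  | .two => 2
  | .onePlusI => ⟨1, 1⟩

/-- The two descriptions of a multiplier agree in `ℂ`. [folklore] -/
theorem Mult.toComplex_toZi (m : Mult) : ((m.toZi : GaussianInt) : ℂ) = m.toC := by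
  cases m
  · exact GaussianInt.toComplex_zero
  · exact GaussianInt.toComplex_one
  · show ((2 : GaussianInt) : ℂ) = 2
    rw [show (2 : GaussianInt) = ⟨2, 0⟩ from rfl, GaussianInt.toComplex_def']; simp
  · show (((⟨1, 1⟩ : GaussianInt)) : ℂ) = 1 + I
    rw [GaussianInt.toComplex_def']; simp

/-- `i^e` as a Gaussian integer. [folklore] -/
def iPowZi (e : ℕ) : GaussianInt :=
  if e % 4 = 0 then 1 else if e % 4 = 1 then ⟨0, 1⟩ else if e % 4 = 2 then -1 else ⟨0, -1⟩

/-- `iPowZi e` is `i^e`. [folklore] -/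
theorem toComplex_iPowZi (e : ℕ) : ((iPowZi e : GaussianInt) : ℂ) = I ^ e := by
  rw [Complex.I_pow_eq_pow_mod]
  unfold iPowZi
  have h4 : e % 4 = 0 ∨ e % 4 = 1 ∨ e % 4 = 2 ∨ e % 4 = 3 := by omega
  rcases h4 with h | h | h | h <;> rw [h]
  · simp
  · simp [GaussianInt.toComplex_def']
  · simp
  · simp only [show (3 : ℕ) ≠ 0 from by decide, show (3 : ℕ) ≠ 1 from by decide,
      show (3 : ℕ) ≠ 2 from by decide, if_false, GaussianInt.toComplex_def']
    rw [pow_succ, Complex.I_sq]; push_cast; ring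

/-! ### First `true` entry of a bit list -/

/-- Index of the first `true` entry (the length if there is none). [folklore] -/
def firstTrue : List Bool → ℕ
  | [] => 0
  | true :: _ => 0
  | false :: l => firstTrue l + 1

/-- The first `true` entry is `true`. [folklore] -/
theorem getD_firstTrue {l : List Bool} (h : true ∈ l) : l.getD (firstTrue l) false = true := by
  induction l with
  | nil => simp at h
  | cons b l ih =>
    cases b
    · simp only [firstTrue, List.getD_cons_succ]
      exact ih (by simpa using h)
    · rfl

/-- The first `true` entry is within the list. [folklore] -/
theorem firstTrue_lt_length {l : List Bool} (h : true ∈ l) : firstTrue l < l.length := by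
  induction l with
  | nil => simp at h
  | cons b l ih =>
    cases b
    · simp only [firstTrue, List.length_cons]
      exact Nat.succ_lt_succ (ih (by simpa using h))
    · simp [firstTrue]

/-! ### The two one-variable identities -/

/-- The odd-`λ` identity: `1 + i^λ (−1)^e = (1 + i) · i^{e₀} · (i^{e})^{e₁}` with
`(e₀, e₁) = (0, 3)` for `λ ≡ 1` and `(3, 1)` for `λ ≡ 3 (mod 4)`.
[cite: BravyiGosset2016, App. A] -/
theorem one_add_I_pow_odd (lam : ℕ) (hodd : lam % 2 = 1) (e : Bool) :
    1 + I ^ lam * (-1 : ℂ) ^ Bool.toNat e =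
      (1 + I) * I ^ (if lam % 4 = 3 then 3 else 0) * (I ^ Bool.toNat e) ^ (if lam % 4 = 3 then 1 else 3) := by
  rw [Complex.I_pow_eq_pow_mod lam]
  have h : lam % 4 = 1 ∨ lam % 4 = 3 := by omega
  rcases h with h | h <;> rw [h] <;> cases e <;> simp [pow_succ, Complex.I_mul_I] <;> ring_nf <;>
    simp [Complex.I_sq] <;> ring

/-- The even-`λ` identity: `1 + i^λ (−1)^e = 2 · [e = (λ ≡ 2 mod 4)]`.
[cite: BravyiGosset2016, App. A] -/
theorem one_add_I_pow_even (lam : ℕ) (heven : lam % 2 = 0) (e : Bool) :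
    1 + I ^ lam * (-1 : ℂ) ^ Bool.toNat e = if e = decide (lam % 4 = 2) then 2 else 0 := by
  rw [Complex.I_pow_eq_pow_mod lam]
  have h : lam % 4 = 0 ∨ lam % 4 = 2 := by omega
  rcases h with h | h <;> rw [h] <;> cases e <;> simp [Complex.I_sq] <;> norm_num

namespace GData

/-! ### One elimination step -/

/-- **One elimination step** (from `k + 1` to `k` variables, eliminating `w_k`). With `λ = Λ_k` and
`b = (B_{kj})_{j<k}`:
* `λ` odd: multiplier `1 + i`, and the phase `i^{e₀} (i^{[b·w]})^{e₁}` is absorbed by `addMu`,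
  `addPhaseForm`;
* `λ` even, `b = 0`: multiplier `2` if `λ ≡ 0`, `0` if `λ ≡ 2 (mod 4)`;
* `λ` even, `b ≠ 0`: the constraint `b·w = λ/2` is solved for the first variable `w_p` with
  `b_p = 1`; substituting `w_p := f(w)` (`f = λ/2 ⊕ ⊕_{j ≠ p} b_j w_j`) into the terms containing
  `w_p` (`i^{Λ_p w_p}`, `(−1)^{w_p · colrow_p(w)}`) and keeping `w_p` as a dummy variable absorbs the
  factor `2`: multiplier `1`.
[cite: BravyiGosset2016, App. A (eq. (W), ExponentialSum)] -/
def elimStep (k : ℕ) (D : GData) : Mult × GData :=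
  let lam := D.lamAt k
  let b : List Bool := (List.range k).map fun j => D.entry k j
  let D₀ := restrict k D
  if lam % 2 = 1 then
    (Mult.onePlusI,
      addMu (if lam % 4 = 3 then 3 else 0) (addPhaseForm (if lam % 4 = 3 then 1 else 3) ⟨false, b⟩ D₀))
  else if b.all (fun x => !x) then
    (if lam % 4 = 2 then Mult.zero else Mult.two, D₀)
  else
    let p := firstTrue b
    let f : AffForm := (⟨false, b.set p false⟩ : AffForm).addConst (decide (lam % 4 = 2))
    (Mult.one, zeroVar p (addQuadProduct f (colrow k p D₀) (addPhaseForm (D₀.lamAt p) f D₀)))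

/-- **Correctness of one elimination step**: `Γ_{k+1}(D) = m · Γ_k(D')` for
`(m, D') = elimStep k D`. [cite: BravyiGosset2016, App. A (eq. (W), ExponentialSum)] -/
theorem gsum_succ (k : ℕ) (D : GData) :
    gsum (k + 1) D = (elimStep k D).1.toC * gsum k (elimStep k D).2 := by
  -- sum out the last variable
  have hsplit : gsum (k + 1) D =
      ∑ w : Fin k → Bool, (restrict k D).val k w *
        (1 + I ^ D.lamAt k * (-1 : ℂ) ^ Bool.toNat ((lastForm k D).eval w)) := by
    unfold gsum
    rw [sum_snoc]
    exact Finset.sum_congr rfl fun w _ => by rw [val_snoc_false_add_true, val_restrict]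
  rw [hsplit]
  unfold elimStep
  simp only
  set lam := D.lamAt k with hlam
  set b : List Bool := (List.range k).map fun j => D.entry k j with hb
  have hbf : (⟨false, b⟩ : AffForm) = lastForm k D := rfl
  set D₀ := restrict k D with hD₀
  rcases Nat.mod_two_eq_zero_or_one lam with heven | hodd
  · -- even `λ`
    rw [if_neg (by omega)]
    have hev : ∀ w : Fin k → Bool, (1 + I ^ lam * (-1 : ℂ) ^ Bool.toNat ((lastForm k D).eval w)) =
        if (lastForm k D).eval w = decide (lam % 4 = 2) then 2 else 0 := fun w =>
      one_add_I_pow_even lam heven _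
    simp only [hev]
    by_cases hall : b.all (fun x => !x) = true
    · -- `b = 0`: the last form is identically `false`
      rw [if_pos hall]
      have hcoef : ∀ j, (lastForm k D).coef j = false := by
        intro j
        rw [← hbf]
        show b.getD j false = false
        by_cases hj : j < b.length
        · have hmem : b.getD j false ∈ b := by
            rw [List.getD_eq_getElem _ _ hj]; exact List.getElem_mem hj
          have := List.all_eq_true.1 hall _ hmem
          revert this
          cases b.getD j false <;> simp
        · exact List.getD_eq_default _ _ (Nat.not_lt.1 hj)
      have hev0 : ∀ w : Fin k → Bool, (lastForm k D).eval w = false := by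
        intro w
        unfold AffForm.eval AffForm.lift
        rw [Finset.sum_eq_zero (fun j _ => by rw [hcoef]; rfl)]
        rfl
      simp only [hev0]
      by_cases h2 : lam % 4 = 2
      · simp [h2, Mult.toC, gsum]
      · simp only [h2, decide_false, if_true, if_false, Mult.toC, gsum, Finset.mul_sum]
        exact Finset.sum_congr rfl fun w _ => by ring
    · -- `b ≠ 0`: substitution for the pivot `p`
      rw [if_neg hall]
      simp only [Mult.toC, one_mul]
      have hmem : true ∈ b := by
        obtain ⟨x, hx, hx'⟩ := List.all_eq_false.1 (Bool.eq_false_iff.2 hall)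
        cases x
        · simp at hx'
        · exact hx
      have hpk : firstTrue b < k := by simpa [hb] using firstTrue_lt_length hmem
      -- `k = k' + 1`
      obtain ⟨k', rfl⟩ : ∃ k', k = k' + 1 := ⟨k - 1, by omega⟩
      set p : ℕ := firstTrue b with hp
      set pF : Fin (k' + 1) := ⟨p, hpk⟩ with hpF
      set f₀ : AffForm := ⟨false, b.set p false⟩ with hf₀
      set f : AffForm := f₀.addConst (decide (lam % 4 = 2)) with hf
      set g : AffForm := colrow (k' + 1) p D₀ with hg
      have hfp : f.coef p = false := by
        show (b.set p false).getD p false = false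
        rw [getD_set_default, if_pos rfl]
      have hgp : g.coef p = false := by
        rw [hg, coef_colrow]; simp
      -- the last form is `f₀ ⊕ w_p`, by coefficients
      have hcoefL : ∀ j, (lastForm (k' + 1) D).coef j = (f₀.coef j ^^ (AffForm.unit p).coef j) := by
        intro j
        rw [← hbf, AffForm.coef_unit]
        show b.getD j false = ((b.set p false).getD j false ^^ decide (j = p))
        rw [getD_set_default]
        by_cases hjp : j = p
        · subst hjp
          rw [if_pos rfl, hp, getD_firstTrue hmem]; simp
        · simp [hjp]
      have hevL : ∀ w : Fin (k' + 1) → Bool, (lastForm (k' + 1) D).eval w = (f₀.eval w ^^ w pF) := by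
        intro w
        rw [← AffForm.eval_unit p hpk w, ← AffForm.eval_add]
        exact AffForm.eval_congr (f := lastForm (k' + 1) D) (g := f₀.add (AffForm.unit p)) rfl
          (fun j => (hcoefL j).trans (AffForm.coef_add f₀ (AffForm.unit p) j).symm) w
      -- the new data at `w` is the old data at `w[p ↦ f w]`
      have hval : ∀ w : Fin (k' + 1) → Bool,
          (zeroVar p (addQuadProduct f g (addPhaseForm (D₀.lamAt p) f D₀))).val (k' + 1) w =
            D₀.val (k' + 1) (Function.update w pF (f.eval w)) := by
        intro w
        have hz := val_zeroVar (addQuadProduct f g (addPhaseForm (D₀.lamAt p) f D₀)) w pF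
        rw [show ((pF : ℕ)) = p from rfl] at hz
        rw [hz, val_addQuadProduct, val_addPhaseForm, AffForm.eval_update_of_coef f w pF _ hfp,
          AffForm.eval_update_of_coef g w pF _ hgp, D₀.val_update w pF (f.eval w), ← pow_mul,
          mul_comm (Bool.toNat (f.eval w))]
      unfold gsum
      rw [Finset.sum_congr rfl fun w _ => hval w,
        sum_update_eq_two_mul pF _ f.eval (fun w c => AffForm.eval_update_of_coef f w pF c hfp),
        Finset.mul_sum]
      refine Finset.sum_congr rfl fun w _ => ?_
      rw [hevL w, hf, AffForm.eval_addConst]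
      cases f₀.eval w <;> cases w pF <;> cases decide (lam % 4 = 2) <;> simp [mul_comm]
  · -- odd `λ`
    rw [if_pos hodd]
    simp only [Mult.toC, gsum, Finset.mul_sum]
    refine Finset.sum_congr rfl fun w _ => ?_
    rw [val_addMu, val_addPhaseForm, hbf, one_add_I_pow_odd lam hodd]
    ring

/-! ### The evaluator -/

/-- **The exact evaluator** of `Γ_k(D)` by `k` elimination steps, with values in the Gaussian
integers `ℤ[i]`. [cite: BravyiGosset2016, App. A (eq. (W), ExponentialSum)] -/
def gaussEval : ℕ → GData → GaussianInt
  | 0, D => iPowZi D.mu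
  | k + 1, D => (elimStep k D).1.toZi * gaussEval k (elimStep k D).2

/-- The sum over the unique valuation of zero variables is `i^μ`. [folklore] -/
theorem gsum_zero (D : GData) : gsum 0 D = I ^ D.mu := by
  unfold gsum
  rw [Fintype.sum_unique]
  unfold val expI expNeg
  simp

/-- **Correctness of the evaluator**: `gaussEval k D = Σ_{w ∈ 𝔽₂^k} i^{μ + Λ·w} (−1)^{B(w)}`.
[cite: BravyiGosset2016, App. A (eq. (W), ExponentialSum)] -/
theorem toComplex_gaussEval (k : ℕ) (D : GData) : ((gaussEval k D : GaussianInt) : ℂ) = gsum k D := by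
  induction k generalizing D with
  | zero => rw [gaussEval, toComplex_iPowZi, gsum_zero]
  | succ k ih => rw [gaussEval, GaussianInt.toComplex_mul, Mult.toComplex_toZi, ih, gsum_succ]

end GData

end Literature.Computability.QuantumComplexity.BravyiGosset
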